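import Summits.ResolutionOfSingularities.ResolutionOfSingularities.Theorems.HilbertSamuelEliminationCampaignW42RidgeConeBlowup
import Literature.AlgebraicGeometry.Resolution.RidgeRepresentable
import HarnessLib

/-!
# [OURS · L1 W4.2] Ridge confinement at ALL closed points over an algebraically closed field: a closed point
# of a cone (or of the exceptional divisor of the blow-up of its vertex) is near iff it lies on the ridge
# scheme `V(𝔉)` (campaign s42 of cell res-hironaka, LADDER-RESOLUTION rung L; informal crux
# `RidgeConfinement`, stmt-ResolutionOfSingularities-17845; `--supports`)

HONEST FRAMING. OURS (slot W4.2, prover res-L1-s42-pv-1, gen 2): over an ALGEBRAICALLY CLOSED field every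
closed point is rational (Hilbert's Nullstellensatz, Mathlib `MvPolynomial.isMaximal_iff_eq_vanishingIdeal_singleton`),
so the rational-point theorems of `…CampaignW42RidgeConeNear.lean` / `…RidgeConeBlowup.lean` become statements
about ALL closed points, phrased with maximal ideals `𝔮` and the ridge IDEAL `𝔉 = ridgeIdeal I` (the closed
subscheme `V(𝔉)` representing Giraud's functor, `Literature.AlgebraicGeometry.Resolution.mem_ridge_iff_forall_ridgeIdeal`).
Classical mathematics (Hironaka 1970; Giraud 1975 §1.5; BHM 2010 Prop.–Def. 2.1; CJS 2020 Rem. 18.29); NOTHING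
here is a statement of H. Hironaka's manuscript [Hironaka2017]. Closed points with a non-trivial (e.g.
inseparable) residue extension over a NON-closed field are NOT covered by this file. AI review is weaker than
expert review.

* `exists_eq_ker_eval_of_isMaximal` — every maximal ideal of `K[X_1, …, X_n]`, `K = K̄`, is `𝔪_v = ker(eval v)`;
  `exists_eq_ker_eval_of_isMaximal_of_X_mem` — if moreover `X_j ∈ 𝔮` then `v_j = 0`;
* `finrank_quotient_sup_pow_le_of_isMaximal` — semicontinuity `dim_K S/(I + 𝔮^{d+1}) ≤ dim_K S/(I + 𝔪^{d+1})`
  at every closed point of the cone;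
* **`ridgeIdeal_le_iff_near_of_isMaximal`** — for a homogeneous `I` and a maximal `𝔮`: `𝔉 ≤ 𝔮` (the closed
  point lies on the ridge) iff `dim_K S/(I + 𝔮^{d+1}) = dim_K S/(I + 𝔪^{d+1})` for all `d` (it is near to the
  vertex); `ridgeIdeal_le_of_finrank_le` (near ⟹ on the ridge);
* **`ridgeIdeal_le_iff_near_exceptional_of_isMaximal`** — for a closed point `𝔮' ⊇ J + (X_j)` of the
  exceptional divisor of the chart `j` of the blow-up of the vertex (`J = I.map (dehomog K j)` the strict
  transform): writing `𝔮' = 𝔪_b` (`b_j = 0`), the point is near (`dim_K S/(J + 𝔮'^{d+1}) = dim_K S/(I + 𝔪^{d+1})`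
  for all `d`) iff its direction lies on the ridge: `𝔉 ≤ 𝔪_{b + e_j}`.

References (orientation only): H. Hironaka, Ann. of Math. 92 (1970); J. Giraud, Ann. Sci. ÉNS 8 (1975) §1.5;
J. Berthomieu, P. Hivert, H. Mourtada, Contemp. Math. 521 (2010), Prop.–Def. 2.1; V. Cossart, U. Jannsen,
S. Saito, LNM 2270 (2020), Def. 3.13, Rem. 18.29.
-/

noncomputable section

-- single-conjunct summit: the doubled namespace component `ResolutionOfSingularities` is mandated
set_option linter.dupNamespace false

open MvPolynomial Module
open Literature.RingTheory.HilbertSamuel (IsHomogeneousIdeal)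
open Literature.AlgebraicGeometry.Resolution

namespace Summit.ResolutionOfSingularities.ResolutionOfSingularities.Theorems

namespace CampaignW42

universe u

variable {K : Type u} [Field K] [IsAlgClosed K] {n : ℕ}

/-! ## Closed points are rational (Nullstellensatz) -/

/-- Over an algebraically closed field every maximal ideal of `K[X_1, …, X_n]` is the ideal `𝔪_v = ker(eval v)`
of a rational point (Hilbert's Nullstellensatz, Mathlib). [folklore] -/
theorem exists_eq_ker_eval_of_isMaximal (𝔮 : Ideal (MvPolynomial (Fin n) K)) [h𝔮 : 𝔮.IsMaximal] :
    ∃ v : Fin n → K, 𝔮 = RingHom.ker (eval v) := by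
  obtain ⟨v, hv⟩ := MvPolynomial.isMaximal_iff_eq_vanishingIdeal_singleton.mp h𝔮
  refine ⟨v, ?_⟩
  rw [hv]
  ext p
  rw [MvPolynomial.mem_vanishingIdeal_singleton_iff, RingHom.mem_ker]
  exact Iff.rfl

/-- A closed point of the hyperplane `{X_j = 0}` (e.g. of the exceptional divisor of the chart `j`):
`𝔮 = 𝔪_v` with `v_j = 0`. [folklore] -/
theorem exists_eq_ker_eval_of_isMaximal_of_X_mem (𝔮 : Ideal (MvPolynomial (Fin n) K)) [𝔮.IsMaximal]
    {j : Fin n} (hj : (X j : MvPolynomial (Fin n) K) ∈ 𝔮) :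
    ∃ v : Fin n → K, v j = 0 ∧ 𝔮 = RingHom.ker (eval v) := by
  obtain ⟨v, rfl⟩ := exists_eq_ker_eval_of_isMaximal 𝔮
  refine ⟨v, ?_, rfl⟩
  rw [RingHom.mem_ker, eval_X] at hj
  exact hj

omit [IsAlgClosed K] in
/-- `𝔉 ≤ 𝔪_v` iff `v ∈ F(C)(K)`: the rational point lies on the closed subscheme `V(𝔉)` representing Giraud's
functor (BHM Prop.–Def. 2.1, tree `mem_ridge_iff_forall_ridgeIdeal`).
[cite: BerthomieuHivertMourtada2010, Prop. 2.1] -/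
theorem ridgeIdeal_le_ker_eval_iff {I : Ideal (MvPolynomial (Fin n) K)} (v : Fin n → K) :
    ridgeIdeal I ≤ RingHom.ker (eval v) ↔ v ∈ ridge K I := by
  rw [mem_ridge_iff_forall_ridgeIdeal]
  refine forall₂_congr fun g _ => ?_
  rw [RingHom.mem_ker]
  exact Iff.rfl

/-! ## The cone: near closed points are the closed points of the ridge -/

/-- **Semicontinuity at every closed point of the cone** (over `K = K̄`): `dim_K S/(I + 𝔮^{d+1}) ≤
dim_K S/(I + 𝔪^{d+1})` for a homogeneous ideal `I` and a maximal ideal `𝔮`. [folklore] -/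
theorem finrank_quotient_sup_pow_le_of_isMaximal {I : Ideal (MvPolynomial (Fin n) K)}
    (hI : IsHomogeneousIdeal I) (𝔮 : Ideal (MvPolynomial (Fin n) K)) [𝔮.IsMaximal] (d : ℕ) :
    finrank K (MvPolynomial (Fin n) K ⧸ (I ⊔ 𝔮 ^ (d + 1))) ≤
      finrank K (MvPolynomial (Fin n) K ⧸ (I ⊔ idealOfVars (Fin n) K ^ (d + 1))) := by
  obtain ⟨v, rfl⟩ := exists_eq_ker_eval_of_isMaximal 𝔮
  exact finrank_quotient_sup_ker_eval_pow_le hI v d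

/-- **Ridge confinement at ALL closed points of a cone over an algebraically closed field**: for a homogeneous
ideal `I ⊆ K[X_1, …, X_n]`, `K = K̄`, and a closed point `𝔮` (a maximal ideal), `𝔮` lies on the ridge scheme
`V(𝔉)` — `ridgeIdeal I ≤ 𝔮` — iff the Hilbert–Samuel numbers of the cone at `𝔮` are those of the vertex:
`dim_K S/(I + 𝔮^{d+1}) = dim_K S/(I + 𝔪^{d+1})` for all `d`. [cite: Giraud1975, §1.5] -/
theorem ridgeIdeal_le_iff_near_of_isMaximal {I : Ideal (MvPolynomial (Fin n) K)} (hI : IsHomogeneousIdeal I)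
    (𝔮 : Ideal (MvPolynomial (Fin n) K)) [𝔮.IsMaximal] :
    ridgeIdeal I ≤ 𝔮 ↔ ∀ d : ℕ, finrank K (MvPolynomial (Fin n) K ⧸ (I ⊔ 𝔮 ^ (d + 1))) =
      finrank K (MvPolynomial (Fin n) K ⧸ (I ⊔ idealOfVars (Fin n) K ^ (d + 1))) := by
  obtain ⟨v, rfl⟩ := exists_eq_ker_eval_of_isMaximal 𝔮
  rw [ridgeIdeal_le_ker_eval_iff, mem_ridge_iff_finrank_quotient_ker_eval_eq hI v]

/-- **Near ⟹ on the ridge**, at every closed point (`K = K̄`): if `dim_K S/(I + 𝔪^{d+1}) ≤ dim_K S/(I + 𝔮^{d+1})`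
for all `d` then `ridgeIdeal I ≤ 𝔮`. [cite: Giraud1975, §1.5] -/
theorem ridgeIdeal_le_of_finrank_le {I : Ideal (MvPolynomial (Fin n) K)} (hI : IsHomogeneousIdeal I)
    (𝔮 : Ideal (MvPolynomial (Fin n) K)) [𝔮.IsMaximal]
    (h : ∀ d : ℕ, finrank K (MvPolynomial (Fin n) K ⧸ (I ⊔ idealOfVars (Fin n) K ^ (d + 1))) ≤
      finrank K (MvPolynomial (Fin n) K ⧸ (I ⊔ 𝔮 ^ (d + 1)))) :
    ridgeIdeal I ≤ 𝔮 := by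
  obtain ⟨v, rfl⟩ := exists_eq_ker_eval_of_isMaximal 𝔮
  exact (ridgeIdeal_le_ker_eval_iff v).mpr (mem_ridge_of_finrank_quotient_ker_eval_le hI v h)

/-! ## The blow-up of the vertex: near closed points of the exceptional divisor -/

/-- **Ridge confinement at ALL closed points of the exceptional divisor** of the blow-up of the vertex of a cone
over `K = K̄`, chart `j` (`J = I.map (dehomog K j)` the strict transform ideal): a closed point `𝔮' ⊇ J + (X_j)`
is `𝔪_b` with `b_j = 0`, and it is near — `dim_K S/(J + 𝔮'^{d+1}) = dim_K S/(I + 𝔪^{d+1})` for all `d` —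
iff its direction `b + e_j` lies on the ridge scheme: `ridgeIdeal I ≤ 𝔪_{b+e_j}`. [cite: Giraud1975, §1.5] -/
theorem ridgeIdeal_le_iff_near_exceptional_of_isMaximal {I : Ideal (MvPolynomial (Fin n) K)}
    (hI : IsHomogeneousIdeal I) (j : Fin n) (𝔮' : Ideal (MvPolynomial (Fin n) K)) [𝔮'.IsMaximal]
    (hXj : (X j : MvPolynomial (Fin n) K) ∈ 𝔮') :
    ∃ b : Fin n → K, b j = 0 ∧ 𝔮' = RingHom.ker (eval b) ∧
      (ridgeIdeal I ≤ RingHom.ker (eval (b + Pi.single j 1)) ↔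
        ∀ d : ℕ, finrank K (MvPolynomial (Fin n) K ⧸ (I.map (dehomog K j) ⊔ 𝔮' ^ (d + 1))) =
          finrank K (MvPolynomial (Fin n) K ⧸ (I ⊔ idealOfVars (Fin n) K ^ (d + 1)))) := by
  obtain ⟨b, hb, rfl⟩ := exists_eq_ker_eval_of_isMaximal_of_X_mem 𝔮' hXj
  refine ⟨b, hb, rfl, ?_⟩
  rw [ridgeIdeal_le_ker_eval_iff, add_single_mem_ridge_iff_near hI j hb]

/-- **Near ⟹ direction on the ridge**, closed points of the exceptional divisor (`K = K̄`).
[cite: Giraud1975, §1.5] -/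
theorem ridgeIdeal_le_of_finrank_le_exceptional {I : Ideal (MvPolynomial (Fin n) K)}
    (hI : IsHomogeneousIdeal I) (j : Fin n) (𝔮' : Ideal (MvPolynomial (Fin n) K)) [𝔮'.IsMaximal]
    (hXj : (X j : MvPolynomial (Fin n) K) ∈ 𝔮')
    (h : ∀ d : ℕ, finrank K (MvPolynomial (Fin n) K ⧸ (I ⊔ idealOfVars (Fin n) K ^ (d + 1))) ≤
      finrank K (MvPolynomial (Fin n) K ⧸ (I.map (dehomog K j) ⊔ 𝔮' ^ (d + 1)))) :
    ∃ b : Fin n → K, b j = 0 ∧ 𝔮' = RingHom.ker (eval b) ∧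
      ridgeIdeal I ≤ RingHom.ker (eval (b + Pi.single j 1)) := by
  obtain ⟨b, hb, rfl⟩ := exists_eq_ker_eval_of_isMaximal_of_X_mem 𝔮' hXj
  exact ⟨b, hb, rfl, (ridgeIdeal_le_ker_eval_iff _).mpr (add_single_mem_ridge_of_finrank_le hI j hb h)⟩

end CampaignW42

end Summit.ResolutionOfSingularities.ResolutionOfSingularities.Theorems
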